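import Mathlib
import HarnessLib
import Summits.AnomalousDissipation.AnomalousDissipation.Theses.LimitingAbsorption
import Summits.AnomalousDissipation.AnomalousDissipation.Theorems.LimitingAbsorptionUniformRelaxationWitnessStubMeanEnergyGlue
import Summits.AnomalousDissipation.AnomalousDissipation.Theorems.LimitingAbsorptionUniformRelaxationWitnessPeriodicTransfer
import Summits.AnomalousDissipation.AnomalousDissipation.Theorems.LimitingAbsorptionUniformRelaxationWitnessOneSolutionGlue

/-!
# Recurrent-family transfer for `LimitingAbsorption.UniformRelaxationWitness`
# (line `Sketch`, crux stmt-AnomalousDissipation-2937) — the skeleton's composition, Theorems-side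

The composition `UniformRelaxationWitness_of` of the registered skeleton
`Cruxes/UniformRelaxationWitness/Lines/Sketch.lean` (v3), with its single open stub
`stub_recurrentSymmetricStatesOne` turned into hypotheses: a steady smooth solenoidal mean-zero
planar force `g`, a smooth mean-zero profile `h`, `ν_j → 0`, TIME-PERIODIC global Leray–Hopf
solutions `v_j` (periods `T_j > 0`), locally bounded, with POINTWISE energy `∫⁻ ‖v_j t‖ₑ² ≤ E` on
`t ≥ 0`, such that from every release phase of ONE period and on every horizon SOME weak scalar
released with datum `h` decays at the ν-uniform exponential rate `(C, γ)`, and with the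
absorbed-power floor — give the crux. Chain of landed lemmas: `stub_meanEnergyGlue` (pointwise ⇒
mean energy), `relaxation_allSolutions_of_oneSolution` (one weak solution ⇒ all, bounded-drift
uniqueness), `uniformRelaxationWitness_of_periodicFamily` (one period ⇒ all phases ⇒ crux). The
point symmetry and the period cap `T_j ≤ T₀` of the line's stub are design constraints and are not
needed here.
-/

open MeasureTheory Set Filter
open scoped ENNReal

noncomputable section

set_option linter.dupNamespace false

namespace Summit.AnomalousDissipation.AnomalousDissipation.Theorems

open Literature.Analysis.FluidPDE Literature.Analysis.FunctionSpaces
open Summit.AnomalousDissipation.AnomalousDissipation.Theses.LimitingAbsorption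

/-- **Recurrent-family transfer (registered composition of line `Sketch`, conditional form).**
Periodic locally bounded Leray–Hopf family with pointwise bounded energy + one-solution one-period
ν-uniform relaxation of the profile + absorbed-power floor ⇒ `UniformRelaxationWitness`. -/
theorem uniformRelaxationWitness_of_recurrentFamilyOne :
    ∀ (g : UnitAddTorus (Fin 2) → EuclideanSpace ℝ (Fin 2)) (h : UnitAddTorus (Fin 2) → ℝ),
      Literature.Analysis.FunctionSpaces.Torus.IsSmooth g →
      Literature.Analysis.FunctionSpaces.Torus.IsDivFree g →
      Literature.Analysis.FunctionSpaces.Torus.HasZeroMean g →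
      Literature.Analysis.FunctionSpaces.Torus.IsSmooth h →
      Literature.Analysis.FunctionSpaces.Torus.HasZeroMean h →
      ∀ (ν T : ℕ → ℝ) (E : ℝ) (v₀ : ℕ → UnitAddTorus (Fin 2) → EuclideanSpace ℝ (Fin 2))
        (v : ℕ → ℝ → UnitAddTorus (Fin 2) → EuclideanSpace ℝ (Fin 2)),
        (∀ j, 0 < ν j) → Filter.Tendsto ν Filter.atTop (nhds 0) → (∀ j, 0 < T j) →
        (∀ j, Literature.Analysis.FluidPDE.Torus.IsGlobalLerayHopf (ν j) (fun _ => g) (v₀ j) (v j)) →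
        (∀ j (T' : ℝ), 0 < T' → MeasureTheory.MemLp (Literature.Analysis.FunctionSpaces.Torus.stLift (v j)) ⊤
          (MeasureTheory.volume.restrict (Set.Ioo (0 : ℝ) T' ×ˢ Set.univ))) →
        (∀ j, Function.Periodic (v j) (T j)) →
        (∀ j (t : ℝ), 0 ≤ t → ∫⁻ x, ‖v j t x‖ₑ ^ 2 ≤ ENNReal.ofReal E) →
        (∃ C γ : ℝ, 0 ≤ C ∧ 0 < γ ∧ ∀ j, ∀ s ∈ Set.Icc (0 : ℝ) (T j), ∀ T' : ℝ, 0 < T' →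
          ∃ θ : ℝ → UnitAddTorus (Fin 2) → ℝ,
            Literature.Analysis.FluidPDE.Torus.IsWeakScalarTransportOn T' (ν j) (fun t => v j (s + t)) h θ ∧
              ∀ᵐ t ∂(MeasureTheory.volume.restrict (Set.Ioo (0 : ℝ) T')),
                Literature.Analysis.FluidPDE.Torus.scalarL2Sq (θ t) ≤
                  C * Real.exp (-(γ * t)) * Literature.Analysis.FluidPDE.Torus.scalarL2Sq h) →
        (∃ ε : ℝ, 0 < ε ∧ ∀ j, ∃ θ : ℝ → UnitAddTorus (Fin 2) → ℝ,
          Literature.Analysis.FluidPDE.Torus.IsWeakScalarTransportForced (ν j) (v j) (fun _ => h) 0 θ ∧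
            ε ≤ Literature.Analysis.FluidPDE.longTimeAvgSup
              (fun t => ν j * (Literature.Analysis.FluidPDE.Torus.eScalarGradNormSq (θ t)).toReal)) →
        UniformRelaxationWitness := by
  intro g h hg hgdiv hgmean hh hhmean ν T E v₀ v hν hνlim hT hLH hbd hper hE hU hfloor
  obtain ⟨C, γ, hC, hγ, hU⟩ := hU
  refine uniformRelaxationWitness_of_periodicFamily g h hg hgdiv hgmean hh hhmean ν T v₀ v hν hνlim
    hT hLH hbd hper ⟨max E 0, fun j => stub_meanEnergyGlue (v j) E (hE j)⟩
    ⟨C, γ, hC, hγ, fun j => ?_⟩ hfloor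
  exact relaxation_allSolutions_of_oneSolution (ν j) (v j) h C γ (Set.Icc 0 (T j)) (hν j)
    (fun s hs => Set.mem_Ici.2 hs.1) (hbd j) (hU j)

end Summit.AnomalousDissipation.AnomalousDissipation.Theorems

end
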